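import Summits.RiemannHypothesis.RiemannHypothesis.Theorems.HandoffMarginLaw
import Summits.RiemannHypothesis.RiemannHypothesis.Theorems.SoloInformedOnset
import HarnessLib

/-!
# HANDOFF — slot E-1, the BOUNDED case: «MARGIN(m) ⟹ RH» for a bounded margin law is a «RUNG ⟹ RH» statement (cell rh-explicit, TRACK «HANDOFF», seat theory-1, file XVI)

HONEST FRAMING. Nothing here proves or approaches RH; every theorem is RH-free bookkeeping on existing API
(`HandoffMargin`, `weilSemilocalThreshold`, `WeilPositivityOn`), 0 definitions. It settles referee item HS-29 (a) on
HANDOFF-STATEMENT §J.19 (1)(b) («MARGIN(m) ⟹ RH exactly when it forces unbounded walls» must read «whenever»): the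
tree already proves `MARGIN(m) → RH` WHENEVER `q ↦ m(q) + (log q)/2` is unbounded above along the primes
(`HandoffWallMotion.riemannHypothesis_of_handoffMargin_of_unbounded`). This file says EXACTLY what the implication
«MARGIN(m) ⟹ RH» is worth in the complementary, BOUNDED case (`m(q) + (log q)/2 ≤ T` at every prime):

* RUNG ⟹ MARGIN (`handoffMargin_of_weilPositivityOn`): Weil positivity on `C(T)` gives `MARGIN(m)` for every law
  with `m(q) + (log q)/2 ≤ T` and `m(q) ≤ 0` at the (finitely many) primes `q ≤ e^{2T}` — because below the point
  where `q` becomes visible the `{p < q}`-form IS Weil's form (locality), so `W(q) ≥ min(T, (log q)/2)`;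
* MARGIN ⟹ RUNG (`weilPositivityOn_of_handoffMargin`): `MARGIN(m)` and `m(q) ≤ 0` give Weil positivity on
  `C((log q)/2 + m(q))`, again by locality;
* hence the EXACT STATUS (`handoffMargin_imp_iff_rung_imp`): for `m ≤ 0` whose shifted law `m(q) + (log q)/2` attains
  its maximum `T⋆` at a prime `q⋆`, **`(MARGIN(m) → RH) ↔ (WeilPositivityOn T⋆ → RH)`** — the bounded case of
  slot E-1 is the HYBRID contract's second factor «rung at `T⋆` ⟹ RH», which for `T⋆ = (log q₀)/2` is the INCREMENT
  TAIL `∀ primes q ≥ q₀, H′(q)` (`HandoffFailingStep.forall_ge_handoffStep_iff`): true at every prime but at most one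
  and carrying all of RH past the rung (HANDOFF-STATEMENT §J.13). So the margin row of LOGIC-CARD 2′/2⁗ reads:
  «MARGIN(m) ⟹ RH» is a THEOREM when `m + (log q)/2` is unbounded above, and is RUNG-⟹-RH — no RH-free door — when it
  is bounded (`rung_imp_sandwich` places the rung between «`IH(q)` ⟹ RH» and «`H(q)` ⟹ RH» of the prime window containing
  `T⋆`); under RH it holds (materially) for every `m`, so no «only if» could be a theorem.
* §3 (APPEND): the same exact status WITHOUT attainment — for `m ≤ 0` and the least upper bound `T` of the shifted law
  over the primes, `(MARGIN(m) → RH) ↔ (WeilPositivityOn T → RH)` (`handoffMargin_imp_iff_rung_imp_of_isLUB`), via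
  Yoshida's onset (`IsWeilOnset`, tree `SoloInformedOnset`): every bounded margin law with `m ≤ 0` is worth one rung.
* §4 (APPEND, theory-1 gen10; referee HS-30 (a)): the CLEAN form — a bounded margin law IS one rung:
  **`HandoffMargin m ↔ WeilPositivityOn T`** for the least upper bound `T` of the shifted law
  (`handoffMargin_iff_weilPositivityOn_of_isLUB`; attained form `handoffMargin_iff_weilPositivityOn`), with the sign
  hypothesis only where it is not automatic (`m(q) ≤ 0` at the primes with `(log q)/2 ≤ T`); §2–§3's
  «(MARGIN → RH) ↔ (rung → RH)» are its images under `· → RH` (`imp_congr`; `handoffMargin_imp_iff_rung_imp_of_isLUB₀`);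
  pointwise, a margin law with `m ≤ 0` is the CONJUNCTION of the rungs at `m(q) + (log q)/2` (`handoffMargin_iff_forall_rung`).

References (as printed): H. Yoshida, Adv. Stud. Pure Math. 21 (1992) Prop. 6 p. 320 (the threshold; here with the primes
restricted to `S_q`, `Yoshida1992HermitianForms`); E. Bombieri, Rend. Mat. Acc. Lincei (9) 11 (2000) Thm 2 p. 193
(`Bombieri2000Weil`); A. Connes, C. Consani, Enseign. Math. 69 (2023) §2.1.2 (only the primes `p < λ²` enter `QW_λ`:
locality, `ConnesConsani2023`).
-/

set_option linter.dupNamespace false  -- the mandated namespace repeats `RiemannHypothesis`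

noncomputable section

open Set Literature.NumberTheory.LFunctions
open Summit.RiemannHypothesis.RiemannHypothesis.Theorems.HandoffDecomposition
open Summit.RiemannHypothesis.RiemannHypothesis.Theorems.MotivicDoor.SemilocalThreshold
open Summit.RiemannHypothesis.RiemannHypothesis.Theorems.MotivicDoor.Semilocal
open Summit.RiemannHypothesis.RiemannHypothesis.Theorems.HandoffMarginLaw

namespace Summit.RiemannHypothesis.RiemannHypothesis.Theorems.HandoffMarginRung

variable {m : ℕ → ℝ} {q qs : ℕ} {T a : ℝ}

/-! ## §1  Locality below the entrance of `q`: rung ⟺ wall -/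

/-- **Locality for `S_q = {p < q}` on every window `a ≤ (log q)/2`**: there the `{p < q}`-semilocal form IS Weil's form,
so the two positivity statements coincide (the tree's `weilSemilocalPositivityOn_iff_weilPositivityOn_of_le` with
`N = q − 1`). [cite: ConnesConsani2023, §2.1.2 (only the primes p < λ² enter QW_λ)] -/
theorem weilSemilocalPositivityOn_primesBelow_iff (hq : 1 ≤ q) (ha : a ≤ Real.log q / 2) :
    WeilSemilocalPositivityOn (Nat.primesBelow q) a ↔ WeilPositivityOn a := by
  have hS : ∀ n ≤ q - 1, IsPrimePow n → n.primeFactors ⊆ Nat.primesBelow q := fun n hn _ ↦ by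
    have h := primeFactors_subset_primesBelow hn
    rwa [Nat.sub_add_cancel hq] at h
  have e : Real.log (((q - 1 : ℕ) : ℝ) + 1) / 2 = Real.log q / 2 := by
    rw [show ((q - 1 : ℕ) : ℝ) + 1 = q by exact_mod_cast Nat.sub_add_cancel hq]
  exact weilSemilocalPositivityOn_iff_weilPositivityOn_of_le hS (e ▸ ha)

/-- **RUNG ⟹ WALL**: Weil positivity on `C(T)` with `T ≤ (log q)/2` gives `T ≤ W(q) = a*({p < q})`. [folklore] -/
theorem le_wall_of_weilPositivityOn (hq : 1 ≤ q) (hT : WeilPositivityOn T) (hTq : T ≤ Real.log q / 2) :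
    T ≤ weilSemilocalThreshold (Nat.primesBelow q) :=
  le_weilSemilocalThreshold ((weilSemilocalPositivityOn_primesBelow_iff hq hTq).2 hT)

/-- `min`-form of RUNG ⟹ WALL: `WeilPositivityOn T → min T ((log q)/2) ≤ W(q)` for every `q ≥ 1`. [folklore] -/
theorem min_le_wall_of_weilPositivityOn (hq : 1 ≤ q) (hT : WeilPositivityOn T) :
    min T (Real.log q / 2) ≤ weilSemilocalThreshold (Nat.primesBelow q) :=
  le_wall_of_weilPositivityOn hq (hT.mono (min_le_left _ _)) (min_le_right _ _)

/-- **WALL ⟹ RUNG**: `a ≤ W(q)` with `a ≤ (log q)/2` gives Weil positivity on `C(a)`. [folklore] -/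
theorem weilPositivityOn_of_le_wall (hq : 1 ≤ q) (ha : a ≤ weilSemilocalThreshold (Nat.primesBelow q))
    (haq : a ≤ Real.log q / 2) : WeilPositivityOn a :=
  (weilSemilocalPositivityOn_primesBelow_iff hq haq).1
    (weilSemilocalPositivityOn_iff_le_weilSemilocalThreshold.2 ha)

/-! ## §2  The bounded case of slot E-1 -/

/-- **MARGIN FROM A RUNG** (RH-free): if Weil positivity holds on `C(T)`, then `MARGIN(m)` holds for every margin law with
`m(q) + (log q)/2 ≤ T` at every prime and `m(q) ≤ 0` at the primes with `(log q)/2 ≤ T` (finitely many: `q ≤ e^{2T}`).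
So a BOUNDED margin law is implied by ONE rung plus finitely many sign conditions — it cannot imply RH «RH-free» unless
that rung does. [this track (theory-1), HANDOFF-STATEMENT §J.20] -/
theorem handoffMargin_of_weilPositivityOn (hT : WeilPositivityOn T)
    (hm : ∀ q : ℕ, q.Prime → m q + Real.log q / 2 ≤ T)
    (hm0 : ∀ q : ℕ, q.Prime → Real.log q / 2 ≤ T → m q ≤ 0) : HandoffMargin m := by
  intro q hq
  refine le_trans ?_ (min_le_wall_of_weilPositivityOn hq.one_lt.le hT)
  rcases le_total (Real.log q / 2) T with h | h
  · rw [min_eq_right h]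
    have h0 := hm0 q hq h
    linarith
  · rw [min_eq_left h]
    have h1 := hm q hq
    linarith

/-- **RUNG FROM A MARGIN** (RH-free): `MARGIN(m)` with `m(q) ≤ 0` at a prime `q` gives Weil positivity on
`C((log q)/2 + m(q))`. [this track (theory-1), HANDOFF-STATEMENT §J.20] -/
theorem weilPositivityOn_of_handoffMargin (h : HandoffMargin m) (hq : q.Prime) (hmq : m q ≤ 0) :
    WeilPositivityOn (Real.log q / 2 + m q) :=
  weilPositivityOn_of_le_wall hq.one_lt.le (h q hq) (by linarith)

/-- **EXACT STATUS OF «MARGIN(m) ⟹ RH» IN THE BOUNDED CASE** (RH-free): for a margin law `m ≤ 0` whose shifted law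
`q ↦ m(q) + (log q)/2` attains its maximum over the primes at a prime `q⋆`, with value `T⋆ = (log q⋆)/2 + m(q⋆)`,
`(MARGIN(m) → RH) ↔ (WeilPositivityOn T⋆ → RH)`: the implication is worth exactly «the rung at `T⋆` implies RH» —
the HYBRID contract's second factor, an increment-tail statement (`HandoffFailingStep.forall_ge_handoffStep_iff` for
`T⋆ = (log q₀)/2`), not an RH-free door. Complement: when `m + (log q)/2` is UNBOUNDED above, `MARGIN(m) → RH` outright
(`HandoffWallMotion.riemannHypothesis_of_handoffMargin_of_unbounded`). [this track (theory-1), HANDOFF-STATEMENT §J.20; settles referee HS-29 (a)] -/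
theorem handoffMargin_imp_iff_rung_imp (hm0 : ∀ q : ℕ, q.Prime → m q ≤ 0) (hqs : qs.Prime)
    (hmax : ∀ q : ℕ, q.Prime → m q + Real.log q / 2 ≤ m qs + Real.log qs / 2) :
    (HandoffMargin m → Summit.RiemannHypothesis) ↔
      (WeilPositivityOn (Real.log qs / 2 + m qs) → Summit.RiemannHypothesis) := by
  constructor
  · intro h hW
    refine h (handoffMargin_of_weilPositivityOn hW (fun q hq ↦ ?_) fun q hq _ ↦ hm0 q hq)
    have h1 := hmax q hq
    linarith
  · intro h hM
    exact h (weilPositivityOn_of_handoffMargin hM hqs (hm0 _ hqs))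

/-- **WHERE THE RUNG SITS**: the «rung ⟹ RH» statements are monotone in the rung, so for `T` in the window
`[(log q)/2, (log q⁺)/2]` of a prime `q` the statement «`WeilPositivityOn T` ⟹ RH» of `handoffMargin_imp_iff_rung_imp`
lies between «`IH(q)` ⟹ RH» (`IH(q) = WeilPositivityOn ((log q)/2)`) and «`H(q)` ⟹ RH» (`H(q) ↔ WeilPositivityOn ((log q⁺)/2)`,
`handoffH_iff_weilPositivityOn`) — both increment-tail statements of HANDOFF-STATEMENT §J.13. [this track (theory-1), HANDOFF-STATEMENT §J.20] -/
theorem rung_imp_sandwich (hq : q.Prime) (hT : Real.log q / 2 ≤ T) (hT' : T ≤ Real.log (nextPrime q) / 2) :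
    ((WeilPositivityOn (Real.log q / 2) → Summit.RiemannHypothesis) →
        (WeilPositivityOn T → Summit.RiemannHypothesis)) ∧
      ((WeilPositivityOn T → Summit.RiemannHypothesis) → (HandoffH q → Summit.RiemannHypothesis)) :=
  ⟨fun h hW ↦ h (hW.mono hT), fun h hH ↦ h (((handoffH_iff_weilPositivityOn hq).1 hH).mono hT')⟩

/-! ## §3  The bounded case WITHOUT attainment: the supremum of the shifted law (APPEND, theory-1 gen9)

`handoffMargin_imp_iff_rung_imp` assumed the shifted law `q ↦ m(q) + (log q)/2` ATTAINS its maximum at a prime. For a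
bounded law whose supremum `T` over the primes is NOT attained (e.g. `m(q) = c − (log q)/2 − 1/q`) the same exact status
holds, now through Yoshida's ONSET (`IsWeilOnset`, tree `SoloInformedOnset`): under `¬RH` every positive window lies below
the onset `a₀` and every window below `a₀` is positive, so `MARGIN(m)` pushes `a₀` above every `m(q) + (log q)/2`, hence
above `T`, hence gives the rung at `T`. No new analysis; classical case split on RH. -/

/-- Below an onset every window is positive: `IsWeilOnset a₀ → 0 < a ≤ a₀ → WeilPositivityOn a` (the «⟸» half of
`HandoffFailingStep`'s `IsWeilOnset.weilPositivityOn_iff`, re-derived from the onset API). [cite: Yoshida1992HermitianForms, Prop. 6 (p. 320)] -/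
theorem weilPositivityOn_of_le_onset {a₀ : ℝ} (h : IsWeilOnset a₀) (ha : 0 < a) (hle : a ≤ a₀) :
    WeilPositivityOn a :=
  (weilGroundEnergy_nonneg_iff_holds ha).1 (h.nonneg ha hle)

/-- **EXACT STATUS OF «MARGIN(m) ⟹ RH» IN THE BOUNDED CASE, supremum form** (RH-free): for a margin law `m ≤ 0` and the
least upper bound `T` of `q ↦ m(q) + (log q)/2` over the primes (attained or not),
`(MARGIN(m) → RH) ↔ (WeilPositivityOn T → RH)`. «→»: the rung at `T` gives `MARGIN(m)` by locality
(`handoffMargin_of_weilPositivityOn`). «←»: if RH failed, the onset `a₀` would satisfy `m(q) + (log q)/2 ≤ a₀` at every prime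
(`weilPositivityOn_of_handoffMargin` + `IsWeilOnset.le_of_weilPositivityOn`), hence `T ≤ a₀`, hence `WeilPositivityOn T`
(`weilPositivityOn_of_le_onset`), hence RH — contradiction. So EVERY bounded margin law with `m ≤ 0` is worth exactly one
rung statement. [this track (theory-1), HANDOFF-STATEMENT §J.20; settles referee HS-29 (a) in full generality] -/
theorem handoffMargin_imp_iff_rung_imp_of_isLUB (hm0 : ∀ q : ℕ, q.Prime → m q ≤ 0)
    (hle : ∀ q : ℕ, q.Prime → m q + Real.log q / 2 ≤ T)
    (hlub : ∀ T' < T, ∃ q : ℕ, q.Prime ∧ T' < m q + Real.log q / 2) :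
    (HandoffMargin m → Summit.RiemannHypothesis) ↔
      (WeilPositivityOn T → Summit.RiemannHypothesis) := by
  constructor
  · intro h hW
    exact h (handoffMargin_of_weilPositivityOn hW hle fun q hq _ ↦ hm0 q hq)
  · intro h hM
    by_contra hRH
    obtain ⟨a₀, ha₀⟩ := exists_isWeilOnset_of_not_riemannHypothesis hRH
    have hT : T ≤ a₀ := by
      by_contra hlt
      push Not at hlt
      obtain ⟨q, hq, hq'⟩ := hlub a₀ hlt
      have hle' := ha₀.le_of_weilPositivityOn (weilPositivityOn_of_handoffMargin hM hq (hm0 q hq))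
      linarith
    exact hRH (h ((weilPositivityOn_of_le_onset ha₀ ha₀.pos le_rfl).mono hT))

/-- The supremum form specialises to the attained form: if the maximum is attained at a prime `q⋆` then `T = m(q⋆) + (log q⋆)/2`
is a least upper bound, and `handoffMargin_imp_iff_rung_imp` is recovered (consistency check; same statement up to
`add_comm`). [this track (theory-1), HANDOFF-STATEMENT §J.20] -/
theorem handoffMargin_imp_iff_rung_imp' (hm0 : ∀ q : ℕ, q.Prime → m q ≤ 0) (hqs : qs.Prime)
    (hmax : ∀ q : ℕ, q.Prime → m q + Real.log q / 2 ≤ m qs + Real.log qs / 2) :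
    (HandoffMargin m → Summit.RiemannHypothesis) ↔
      (WeilPositivityOn (m qs + Real.log qs / 2) → Summit.RiemannHypothesis) :=
  handoffMargin_imp_iff_rung_imp_of_isLUB hm0 hmax fun _ hT' ↦ ⟨qs, hqs, hT'⟩

/-! ## §4  The clean form: a bounded margin law IS one rung (APPEND, theory-1 gen10; referee HS-30 (a))

Referee r34, HS-30 (a): §2–§3 state `(MARGIN(m) → RH) ↔ (WeilPositivityOn T → RH)`, but what the arguments establish is
the EQUIVALENCE OF THE ANTECEDENTS, `MARGIN(m) ↔ WeilPositivityOn T`, and the blanket sign hypothesis `m ≤ 0` is only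
needed at the finitely many primes with `(log q)/2 ≤ T` (elsewhere `m(q) ≤ T − (log q)/2 < 0` is automatic from the
bound). Both points are made theorems here. «←» is RUNG ⟹ MARGIN (`handoffMargin_of_weilPositivityOn`, locality). «→»:
`MARGIN(m)` gives the rung at every `m(q) + (log q)/2` (`weilPositivityOn_of_handoffMargin`); the positive windows of
Weil's form are a CLOSED initial segment — all of `ℝ` under RH (`rung_of_riemannHypothesis`), `(−∞, a₀]` with Yoshida's
onset `a₀` otherwise (`IsWeilOnset.le_of_weilPositivityOn`, `weilPositivityOn_of_le_onset`) — so the rung at the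
supremum `T` follows. Classical case split on RH; no new analysis; 0 definitions. Behind all of §2–§4 sits the POINTWISE
form `handoffMargin_iff_forall_rung`: a margin law with `m ≤ 0` is the CONJUNCTION of the rungs at `m(q) + (log q)/2` —
so a bounded law is one rung (the supremum) and an unbounded one is every rung, i.e. RH (`HandoffWallMotion`). -/

/-- **A MARGIN LAW WITH `m ≤ 0` IS A CONJUNCTION OF RUNGS** (RH-free, pointwise form): `MARGIN(m) ↔ ∀ q prime,
WeilPositivityOn (m q + (log q)/2)` — each clause `δ*(q) ≥ m(q)` is, by locality below the entrance of `q` (§1), Weil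
positivity on `C((log q)/2 + m(q))` (the tree's `handoffMargin_iff_forall_weilSemilocalPositivityOn` with the `S_q`-form
replaced by Weil's form, legitimate exactly because `m(q) ≤ 0`). Hence the whole slot E-1 dictionary for `m ≤ 0`: shifted law
BOUNDED ⟹ `MARGIN(m)` is ONE rung (its supremum, `handoffMargin_iff_weilPositivityOn_of_isLUB`); UNBOUNDED ⟹ `MARGIN(m)` is
EVERY rung, i.e. RH (`HandoffWallMotion.riemannHypothesis_of_handoffMargin_of_unbounded`, `HandoffMarginLaw.handoffMargin_of_riemannHypothesis`).
[this track (theory-1), HANDOFF-STATEMENT §J.23; referee HS-30 (a)] -/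
theorem handoffMargin_iff_forall_rung (hm0 : ∀ q : ℕ, q.Prime → m q ≤ 0) :
    HandoffMargin m ↔ ∀ q : ℕ, q.Prime → WeilPositivityOn (m q + Real.log q / 2) := by
  refine ⟨fun h q hq ↦ ?_, fun h q hq ↦ ?_⟩
  · rw [add_comm]
    exact weilPositivityOn_of_handoffMargin h hq (hm0 q hq)
  · have h1 := le_wall_of_weilPositivityOn hq.one_lt.le (h q hq) (by linarith [hm0 q hq])
    linarith

/-- **A BOUNDED MARGIN LAW IS ONE RUNG, supremum form** (RH-free): let `T` be the least upper bound of the shifted law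
`q ↦ m(q) + (log q)/2` over the primes (attained or not) and let `m(q) ≤ 0` at the primes with `(log q)/2 ≤ T`
(finitely many; at every other prime `m(q) < 0` is automatic). Then **`MARGIN(m) ↔ WeilPositivityOn T`**.
So the margin row of slot E-1 reads, in the bounded case: MARGIN(m) is not a statement ABOUT a rung, it IS the rung at
`T = sup_q (m(q) + (log q)/2)` — a theorem iff that rung is one, «⟹ RH» exactly as much as that rung is (one
increment-tail statement, `HandoffFailingStep.forall_ge_handoffStep_iff` — no RH-free door), refuted iff Weil positivity
fails at `T`. [this track (theory-1), HANDOFF-STATEMENT §J.23; settles referee HS-30 (a)] -/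
theorem handoffMargin_iff_weilPositivityOn_of_isLUB
    (hm0 : ∀ q : ℕ, q.Prime → Real.log q / 2 ≤ T → m q ≤ 0)
    (hle : ∀ q : ℕ, q.Prime → m q + Real.log q / 2 ≤ T)
    (hlub : ∀ T' < T, ∃ q : ℕ, q.Prime ∧ T' < m q + Real.log q / 2) :
    HandoffMargin m ↔ WeilPositivityOn T := by
  refine ⟨fun hM ↦ ?_, fun hW ↦ handoffMargin_of_weilPositivityOn hW hle hm0⟩
  -- the sign condition holds at EVERY prime: where `(log q)/2 > T` it follows from the bound `hle`
  have hm0' : ∀ q : ℕ, q.Prime → m q ≤ 0 := fun q hq ↦ by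
    rcases le_or_gt (Real.log q / 2) T with h | h
    · exact hm0 q hq h
    · have h1 := hle q hq
      linarith
  by_contra hW
  -- Weil positivity fails at `T`, so RH fails (every rung is a case of RH; windows `T ≤ (log 2)/2` are theorems)
  have hRH : ¬ Summit.RiemannHypothesis := fun hRH ↦ by
    rcases le_or_gt T (Real.log 2 / 2) with h2 | h2
    · exact hW (weilPositivityOn_of_le_log_two_half h2)
    · have h0 : (0 : ℝ) < Real.log 2 / 2 := by
        have := Real.log_pos (show (1 : ℝ) < 2 by norm_num)
        positivity
      exact hW (MotivicDoor.Rungs.rung_of_riemannHypothesis hRH (h0.trans h2))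
  -- hence Yoshida's onset `a₀` exists; `MARGIN(m)` puts every `m(q) + (log q)/2` below it, so `T ≤ a₀`
  obtain ⟨a₀, ha₀⟩ := exists_isWeilOnset_of_not_riemannHypothesis hRH
  have hT : T ≤ a₀ := by
    by_contra hlt
    push Not at hlt
    obtain ⟨q, hq, hq'⟩ := hlub a₀ hlt
    have hle' := ha₀.le_of_weilPositivityOn (weilPositivityOn_of_handoffMargin hM hq (hm0' q hq))
    linarith
  -- and every window below the onset is positive
  exact hW ((weilPositivityOn_of_le_onset ha₀ ha₀.pos le_rfl).mono hT)

/-- **A BOUNDED MARGIN LAW IS ONE RUNG, attained form** (RH-free): if the shifted law attains its maximum over the primes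
at a prime `q⋆`, with value `T⋆ = m(q⋆) + (log q⋆)/2`, and `m(q) ≤ 0` at the primes with `(log q)/2 ≤ T⋆`, then
**`MARGIN(m) ↔ WeilPositivityOn T⋆`** — the onset is not needed in this case, but the statement is recorded as the
specialisation of the supremum form (consistency). Example: `m(q) = min(0, T₀ − (log q)/2)` (`T₀ ≥ (log 2)/2`) has shifted
law `min((log q)/2, T₀)`, maximum `T⋆ = T₀` attained at every prime `q ≥ e^{2T₀}`, and `MARGIN(m) ↔ WeilPositivityOn T₀` —
the rung itself; by contrast a CONSTANT law `m ≡ c ≤ 0` is unbounded and `MARGIN(c) ↔ RH` (`HandoffWallMotion`).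
[this track (theory-1), HANDOFF-STATEMENT §J.23; settles referee HS-30 (a)] -/
theorem handoffMargin_iff_weilPositivityOn (hqs : qs.Prime)
    (hm0 : ∀ q : ℕ, q.Prime → Real.log q / 2 ≤ m qs + Real.log qs / 2 → m q ≤ 0)
    (hmax : ∀ q : ℕ, q.Prime → m q + Real.log q / 2 ≤ m qs + Real.log qs / 2) :
    HandoffMargin m ↔ WeilPositivityOn (m qs + Real.log qs / 2) :=
  handoffMargin_iff_weilPositivityOn_of_isLUB hm0 hmax fun _ hT' ↦ ⟨qs, hqs, hT'⟩

/-- §3's exact status with the WEAKER sign hypothesis of §4 (only at the primes with `(log q)/2 ≤ T`), as the image of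
`handoffMargin_iff_weilPositivityOn_of_isLUB` under `· → RH` (`imp_congr`): `(MARGIN(m) → RH) ↔ (WeilPositivityOn T → RH)`.
[this track (theory-1), HANDOFF-STATEMENT §J.23; referee HS-30 (a), first clause] -/
theorem handoffMargin_imp_iff_rung_imp_of_isLUB₀
    (hm0 : ∀ q : ℕ, q.Prime → Real.log q / 2 ≤ T → m q ≤ 0)
    (hle : ∀ q : ℕ, q.Prime → m q + Real.log q / 2 ≤ T)
    (hlub : ∀ T' < T, ∃ q : ℕ, q.Prime ∧ T' < m q + Real.log q / 2) :
    (HandoffMargin m → Summit.RiemannHypothesis) ↔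
      (WeilPositivityOn T → Summit.RiemannHypothesis) :=
  imp_congr (handoffMargin_iff_weilPositivityOn_of_isLUB hm0 hle hlub) Iff.rfl

end Summit.RiemannHypothesis.RiemannHypothesis.Theorems.HandoffMarginRung

end
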